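import Literature.NumberTheory.ComplexMultiplication.GaloisCMFieldsPrimeDegreePair
import Literature.NumberTheory.ComplexMultiplication.CMTypeCount
import HarnessLib

/-!
# Two Galois CM fields of degree `≡ 2 (mod 4)`: the PARITY of `[L₀ ∩ L₁ : ℚ]` decides — odd: partial conjugations
# (additive rank); even: a shared imaginary quadratic field (every family of CM types degenerate)

Sequel of `NumberTheory/ComplexMultiplication/GaloisCMFieldsPrimeDegreePair` (this seat), whose dichotomy for two
Galois CM fields of degree `2p` (`p` an odd prime, `L₀ ≠ L₁`) it supersedes: here `K_{i₀}`, `K_{i₁}` are Galois CM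
fields of degrees `2m₀`, `2m₁` with `m₀`, `m₁` ODD — every Galois CM field of degree `≡ 2 (mod 4)`: `ℚ(ζ_p)` for
`p ≡ 3 (mod 4)`, cyclic sextics `k·C`, degree `10`, `14`, `18`, … — with NO hypothesis on `L₀ ≠ L₁` and no primality, and
the deciding invariant is the parity of `d = [L₀ ∩ L₁ : ℚ]` (`L_i = normalClosure ℚ K_i ℂ`):

* §1 **`ringEquiv_apply_conj_of_mem_normalClosure`** — every automorphism `τ` of `ℂ` COMMUTES WITH COMPLEX CONJUGATION
  on the Galois closure of ANY CM field (`ι(x̄) = \overline{ι(x)}` for every embedding `ι`; the equaliser of `τ ∘ conj`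
  and `conj ∘ τ` is a subfield containing every `ι(K)`);
* §2 **`exists_quadratic_le_of_even_finrank`** — for `K` Galois CM of degree `2m`, `m` odd, every subfield `M ≤ L` of
  EVEN degree contains a quadratic field MOVED by conjugation (an imaginary quadratic field): conjugation restricts to
  a central involution `c` of `G = Gal(L/ℚ)` (§1 and the extension of automorphisms of countable subfields to `ℂ`,
  `Motives.ZarhinLie.exists_ringEquiv_complex_comp_eq`), `N = ⟨c⟩` is normal of order `2` and odd index `m`, so by the
  Schur–Zassenhaus theorem (Mathlib's `Subgroup.exists_right_complement'_of_coprime`) it has a complement `Q`, of index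
  `2`, with `c ∉ Q`; `Gal(L/M)` has odd order `[L : M]` and therefore lies in `Q` (`h = (h²)^{(n+1)/2}` and `h² ∈ Q`);
  hence `k = L^Q ≤ M`, `[k : ℚ] = 2`, and `c ∉ Q = Gal(L/k)` moves `k`;
* §3 **`not_isNondegenerateFamily_of_quadratic_le_inf`** — if `L₀ ∩ L₁` contains a quadratic field moved by conjugation
  and `[K_{i₀} : ℚ]/2`, `[K_{i₁} : ℚ]/2` are odd, EVERY family of CM types of the `K_i` is degenerate (the shared
  imaginary quadratic field `k` has odd relative degrees, so both `k`-signature defects are non-zero: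
  `SharedImaginaryQuadraticDegenerate`);
* §4 **`not_isNondegenerateFamily_of_twice_odd_of_even_finrank_inf`** (`d` even ⟹ every family degenerate, no partial
  conjugations), **`forall_exists_partialConj_pair_or_not_isNondegenerateFamily_of_twice_odd`** (the dichotomy by the
  parity of `d`; `d` odd ⟹ partial conjugations is `forall_exists_partialConj_pair_of_odd_finrank`), and
  `even_finrank_inf_iff_exists_conj_ne` (`d` is even iff conjugation moves `L₀ ∩ L₁`).

Everything is proved; no definition, no named fact, no `sorry`.

## References

* [Lang2002] S. Lang, *Algebra*, 3rd ed., GTM 211, VI §1 Thm. 1.1, Cor. 1.4 (Galois correspondence), I §6 (orders).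
* [Rotman1995] J. J. Rotman, *An Introduction to the Theory of Groups*, 4th ed., GTM 148, Thm. 7.41 (Schur–Zassenhaus).
* [Shimura1998] G. Shimura, *Abelian Varieties with Complex Multiplication and Modular Functions*, §18.1–18.2 (CM fields:
  `ι(x^ρ) = \overline{ι(x)}` for every embedding).
* [Gordon1999HodgeAVSurvey] B. B. Gordon, *A survey of the Hodge conjecture for abelian varieties*, §3 Theorem (proof),
  7.5–7.7.
-/

set_option autoImplicit false

noncomputable section

open scoped BigOperators
open NumberField NumberField.ComplexEmbedding Module IntermediateField

namespace Literature.NumberTheory.ComplexMultiplication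

open Literature.AlgebraicGeometry.Motives (CMType)
open Literature.AlgebraicGeometry.Pohlmann1968

variable {I : Type} {K : I → Type} [∀ i, Field (K i)] [∀ i, NumberField (K i)] [∀ i, IsCMField (K i)]

/-! ### Helpers -/

/-- A subfield of a finite extension (inside `ℂ`) is finite. [folklore] -/
private theorem finiteDimensional_of_le₅ {E E' : IntermediateField ℚ ℂ} [FiniteDimensional ℚ E] (h : E' ≤ E) :
    FiniteDimensional ℚ E' :=
  FiniteDimensional.of_injective (IntermediateField.inclusion h).toLinearMap (IntermediateField.inclusion_injective h)

/-- An automorphism of `ℂ` fixes `ℚ`. [folklore] -/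
private theorem ringEquiv_apply_algebraMap₅ (g : ℂ ≃+* ℂ) (q : ℚ) : g (algebraMap ℚ ℂ q) = algebraMap ℚ ℂ q := by
  rw [eq_ratCast]
  exact map_ratCast g q

/-- A finite-dimensional intermediate field of `ℂ/ℚ` is countable. [folklore] -/
private theorem countable_of_finiteDimensional₅ (C : IntermediateField ℚ ℂ) [FiniteDimensional ℚ C] : Countable C :=
  Countable.of_equiv _ (Module.finBasis ℚ C).equivFun.toEquiv.symm

/-- The image in `ℂ` of a CM field is moved by complex conjugation. [folklore] -/
private theorem exists_mem_normalClosure_conj_ne₅ (i : I) : ∃ x ∈ normalClosure ℚ (K i) ℂ, starRingEnd ℂ x ≠ x := by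
  obtain ⟨t⟩ : Nonempty (K i →+* ℂ) := inferInstance
  have ht : ¬ComplexEmbedding.IsReal t := IsTotallyComplex.complexEmbedding_not_isReal t
  rw [ComplexEmbedding.isReal_iff] at ht
  have ht' : ¬∀ y : K i, starRingEnd ℂ (t y) = t y := fun h' =>
    ht (RingHom.ext fun y => by rw [ComplexEmbedding.conjugate_coe_eq, h' y])
  push Not at ht'
  obtain ⟨y, hy⟩ := ht'
  exact ⟨t y, apply_mem_normalClosure i t y, hy⟩

/-! ### §1 Automorphisms of `ℂ` commute with complex conjugation on the Galois closure of a CM field -/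

/-- **Every automorphism `τ` of `ℂ` commutes with complex conjugation on the Galois closure `L` of a CM field `K`**:
`τ(x̄) = \overline{τ(x)}` for `x ∈ L`.  Indeed `ι(x^ρ) = \overline{ι(x)}` for EVERY embedding `ι : K → ℂ` (`ρ` the complex
conjugation of `K`), applied to `ι` and `τ ∘ ι`, shows that the subfield `{x | τ(x̄) = \overline{τ(x)}}` contains every
`ι(K)`, hence their compositum `L`. [cite: Shimura1998, §18.1 (18.2)] -/
theorem ringEquiv_apply_conj_of_mem_normalClosure (τ : ℂ ≃+* ℂ) (i : I) {x : ℂ}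
    (hx : x ∈ normalClosure ℚ (K i) ℂ) : τ (starRingEnd ℂ x) = starRingEnd ℂ (τ x) := by
  let S : IntermediateField ℚ ℂ :=
    (RingHom.eqLocusField (τ.toRingHom.comp (starRingEnd ℂ)) ((starRingEnd ℂ).comp τ.toRingHom)).toIntermediateField
      fun q => by
        rw [RingHom.mem_eqLocusField, RingHom.comp_apply, RingHom.comp_apply, eq_ratCast, map_ratCast,
          RingEquiv.toRingHom_eq_coe, RingEquiv.coe_toRingHom, map_ratCast, map_ratCast]
  have hle : normalClosure ℚ (K i) ℂ ≤ S := by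
    rw [normalClosure_le_iff]
    intro f
    rintro _ ⟨z, rfl⟩
    change (τ.toRingHom.comp (starRingEnd ℂ)) (f z) = ((starRingEnd ℂ).comp τ.toRingHom) (f z)
    have h1 : f.toRingHom (IsCMField.complexConj (K i) z) = starRingEnd ℂ (f.toRingHom z) :=
      IsCMField.complexEmbedding_complexConj (K i) f.toRingHom z
    have h2 : (τ.toRingHom.comp f.toRingHom) (IsCMField.complexConj (K i) z) =
        starRingEnd ℂ ((τ.toRingHom.comp f.toRingHom) z) :=
      IsCMField.complexEmbedding_complexConj (K i) (τ.toRingHom.comp f.toRingHom) z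
    rw [RingHom.comp_apply, RingHom.comp_apply] at h2
    rw [AlgHom.toRingHom_eq_coe, RingHom.coe_coe] at h1 h2
    rw [RingHom.comp_apply, RingHom.comp_apply, ← h1]
    exact h2
  exact hle hx

/-! ### §2 Galois CM fields of degree `2m`, `m` odd: even-degree subfields of the closure contain an imaginary quadratic field -/

/-- **Even-degree subfields of a Galois CM field of degree `2m`, `m` odd, contain an imaginary quadratic field.**  Let
`K` be a Galois CM field with `[K : ℚ] = 2m`, `m` odd, `L` its Galois closure in `ℂ` (`= ι(K)`) and `M ≤ L` a subfield
of EVEN degree.  Then `M` contains a quadratic field `k` with some `x ∈ k`, `x̄ ≠ x`.  Proof: conjugation restricts to a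
central involution `c ∈ G = Gal(L/ℚ)` (§1); `⟨c⟩` is normal of order `2` and odd index `m`, so (Schur–Zassenhaus) it has
a complement `Q`, `[G : Q] = 2`, `c ∉ Q`; `Gal(L/M)` has odd order `[L : M] = 2m/[M : ℚ]`, so each of its elements
`h = (h²)^{(n+1)/2}` lies in `Q` (`h² ∈ Q` as `[G : Q] = 2`); thus `k := L^Q ≤ M`, `[k : ℚ] = [G : Q] = 2`, and `c` moves
`k` since `c ∉ Q = Gal(L/k)`. [cite: Rotman1995, Thm. 7.41] [cite: Lang2002, VI §1 Thm. 1.1 and Cor. 1.4] -/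
theorem exists_quadratic_le_of_even_finrank (i : I) [IsGalois ℚ (K i)] {m : ℕ} (hm : Odd m)
    (hK : finrank ℚ (K i) = 2 * m) {M : IntermediateField ℚ ℂ} (hM : M ≤ normalClosure ℚ (K i) ℂ)
    (hev : Even (finrank ℚ ↥M)) :
    ∃ k : IntermediateField ℚ ℂ, k ≤ M ∧ finrank ℚ ↥k = 2 ∧ ∃ x ∈ k, starRingEnd ℂ x ≠ x := by
  -- pin the instances on `L`
  haveI hN : @Normal ℚ ↥(normalClosure ℚ (K i) ℂ) _ _ (IntermediateField.algebra' _) := normal_normalClosure_complex i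
  letI iL : Algebra ℚ ↥(normalClosure ℚ (K i) ℂ) := IntermediateField.algebra' _
  letI iM' : Algebra ℚ ↥(IntermediateField.restrict hM) := IntermediateField.algebra' _
  haveI : Algebra.IsSeparable ℚ ↥(normalClosure ℚ (K i) ℂ) := Algebra.IsAlgebraic.isSeparable_of_perfectField
  haveI : IsGalois ℚ ↥(normalClosure ℚ (K i) ℂ) := ⟨⟩
  haveI : FiniteDimensional ℚ ↥M := finiteDimensional_of_le₅ hM
  have hL : finrank ℚ (normalClosure ℚ (K i) ℂ) = 2 * m := (finrank_normalClosure_of_normal (K := K i)).trans hK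
  have hG : Nat.card (↥(normalClosure ℚ (K i) ℂ) ≃ₐ[ℚ] ↥(normalClosure ℚ (K i) ℂ)) = 2 * m := by
    rw [IsGalois.card_aut_eq_finrank, hL]
  -- complex conjugation restricted to `L`: an involution …
  let cQ : ℂ ≃ₐ[ℚ] ℂ := AlgEquiv.ofRingEquiv (f := (starRingAut : ℂ ≃+* ℂ)) (ringEquiv_apply_algebraMap₅ _)
  let c : (↥(normalClosure ℚ (K i) ℂ)) ≃ₐ[ℚ] ↥(normalClosure ℚ (K i) ℂ) := cQ.restrictNormal _
  have hc : ∀ y : ↥(normalClosure ℚ (K i) ℂ), ((c y : ↥(normalClosure ℚ (K i) ℂ)) : ℂ) = starRingEnd ℂ y :=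
    fun y => AlgEquiv.restrictNormal_commutes cQ _ y
  have hc2 : c ^ 2 = 1 := by
    rw [pow_two]
    refine AlgEquiv.ext fun y => Subtype.ext ?_
    rw [AlgEquiv.mul_apply, AlgEquiv.one_apply, hc, hc]
    exact Complex.conj_conj _
  have hc1 : c ≠ 1 := by
    obtain ⟨x, hx, hxne⟩ := exists_mem_normalClosure_conj_ne₅ (K := K) i
    intro h
    have := hc ⟨x, hx⟩
    rw [h, AlgEquiv.one_apply] at this
    exact hxne this.symm
  haveI : Fact (Nat.Prime 2) := ⟨Nat.prime_two⟩
  have horder : orderOf c = 2 := orderOf_eq_prime hc2 hc1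
  -- … which is central (§1, after extending each `g ∈ Gal(L/ℚ)` to an automorphism of `ℂ`)
  have hcomm : ∀ g : (↥(normalClosure ℚ (K i) ℂ)) ≃ₐ[ℚ] ↥(normalClosure ℚ (K i) ℂ), Commute g c := by
    intro g
    haveI : Countable ↥(normalClosure ℚ (K i) ℂ) := countable_of_finiteDimensional₅ _
    obtain ⟨τ, hτ⟩ := Literature.AlgebraicGeometry.Motives.ZarhinLie.exists_ringEquiv_complex_comp_eq
      (algebraMap ↥(normalClosure ℚ (K i) ℂ) ℂ)
      ((algebraMap ↥(normalClosure ℚ (K i) ℂ) ℂ).comp g.toRingEquiv.toRingHom)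
    have hτ' : ∀ a : ↥(normalClosure ℚ (K i) ℂ), τ (a : ℂ) = ((g a : ↥(normalClosure ℚ (K i) ℂ)) : ℂ) :=
      fun a => hτ a
    change g * c = c * g
    refine AlgEquiv.ext fun y => Subtype.ext ?_
    change ((g (c y) : ↥(normalClosure ℚ (K i) ℂ)) : ℂ) = ((c (g y) : ↥(normalClosure ℚ (K i) ℂ)) : ℂ)
    rw [hc (g y), ← hτ' (c y), ← hτ' y, hc y]
    exact ringEquiv_apply_conj_of_mem_normalClosure τ i y.2
  -- `N = ⟨c⟩` is normal of order `2` and odd index `m`: Schur–Zassenhaus gives a complement `Q` of index `2`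
  let N : Subgroup ((↥(normalClosure ℚ (K i) ℂ)) ≃ₐ[ℚ] ↥(normalClosure ℚ (K i) ℂ)) := Subgroup.zpowers c
  haveI hNn : N.Normal := by
    refine ⟨fun n hn g => ?_⟩
    obtain ⟨k, rfl⟩ := Subgroup.mem_zpowers_iff.1 hn
    rw [((hcomm g).zpow_right k).eq, mul_inv_cancel_right]
    exact Subgroup.mem_zpowers_iff.2 ⟨k, rfl⟩
  have hNcard : Nat.card N = 2 := by rw [Nat.card_zpowers, horder]
  have hNidx : N.index = m := by
    have h := N.card_mul_index
    rw [hNcard, hG] at h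
    omega
  obtain ⟨Q, hQ⟩ := Subgroup.exists_right_complement'_of_coprime (N := N)
    (by rw [hNcard, hNidx]; exact Nat.coprime_two_left.2 hm)
  have hQcard : Nat.card Q = m := by
    have h := hQ.card_mul
    rw [hNcard, hG] at h
    omega
  have hQidx : Q.index = 2 := by
    have h := Q.card_mul_index
    rw [hQcard, hG, mul_comm 2 m] at h
    exact Nat.eq_of_mul_eq_mul_left hm.pos h
  have hcQ : c ∉ Q := fun h => hc1 (Subgroup.disjoint_def.1 hQ.disjoint (Subgroup.mem_zpowers c) h)
  -- `Gal(L/M)` has odd order `[L : M]`, hence lies in `Q`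
  have hfinM' : finrank ℚ ↥(IntermediateField.restrict hM) = finrank ℚ ↥M :=
    (IntermediateField.restrict_algEquiv hM).toLinearEquiv.finrank_eq.symm
  have hHodd : Odd (Nat.card (IntermediateField.restrict hM).fixingSubgroup) := by
    rw [IsGalois.card_fixingSubgroup_eq_finrank]
    have htower := Module.finrank_mul_finrank ℚ ↥(IntermediateField.restrict hM) ↥(normalClosure ℚ (K i) ℂ)
    rw [hfinM', hL] at htower
    obtain ⟨e, he⟩ := hev
    rw [he] at htower
    refine Odd.of_dvd_nat hm ⟨e, ?_⟩
    have h2 : 2 * (finrank ↥(IntermediateField.restrict hM) ↥(normalClosure ℚ (K i) ℂ) * e) = 2 * m := by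
      rw [← htower]; ring
    omega
  have hHQ : (IntermediateField.restrict hM).fixingSubgroup ≤ Q := by
    intro h hh
    have hdvd := orderOf_dvd_natCard (⟨h, hh⟩ : ↥(IntermediateField.restrict hM).fixingSubgroup)
    rw [Subgroup.orderOf_mk] at hdvd
    obtain ⟨r, hr⟩ := Odd.of_dvd_nat hHodd hdvd
    have hpow : h = (h * h) ^ (r + 1) := by
      rw [← pow_two, ← pow_mul]
      have : 2 * (r + 1) = orderOf h + 1 := by omega
      rw [this, pow_succ, pow_orderOf_eq_one, one_mul]
    rw [hpow]
    exact Q.pow_mem (Subgroup.mul_self_mem_of_index_two hQidx h) _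
  -- `k' = L^Q ≤ M`, quadratic, moved by `c`
  letI ik : Algebra ℚ ↥(IntermediateField.fixedField Q) := IntermediateField.algebra' _
  have hkM : IntermediateField.fixedField Q ≤ IntermediateField.restrict hM := by
    intro x hx
    rw [← IsGalois.fixedField_fixingSubgroup (IntermediateField.restrict hM), IntermediateField.mem_fixedField_iff]
    rw [IntermediateField.mem_fixedField_iff] at hx
    exact fun f hf => hx f (hHQ hf)
  have hkfin : finrank ℚ ↥(IntermediateField.fixedField Q) = 2 := by
    have h1 : finrank ↥(IntermediateField.fixedField Q) ↥(normalClosure ℚ (K i) ℂ) = m := by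
      rw [IntermediateField.finrank_fixedField_eq_card, hQcard]
    have h2 := Module.finrank_mul_finrank ℚ ↥(IntermediateField.fixedField Q) ↥(normalClosure ℚ (K i) ℂ)
    rw [h1, hL] at h2
    exact Nat.eq_of_mul_eq_mul_right hm.pos h2
  have hck : ∃ y ∈ IntermediateField.fixedField Q, c y ≠ y := by
    by_contra hall
    push Not at hall
    exact hcQ (by
      rw [← IntermediateField.fixingSubgroup_fixedField Q, IntermediateField.mem_fixingSubgroup_iff]
      exact hall)
  refine ⟨IntermediateField.lift (IntermediateField.fixedField Q), ?_, ?_, ?_⟩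
  · rintro _ ⟨y, hy, rfl⟩
    exact (IntermediateField.mem_restrict hM y).1 (hkM hy)
  · rw [← hkfin]
    exact (IntermediateField.liftAlgEquiv (IntermediateField.fixedField Q)).toLinearEquiv.finrank_eq.symm
  · obtain ⟨y, hy, hne⟩ := hck
    exact ⟨y, (IntermediateField.mem_lift y).2 hy, fun h => hne (Subtype.ext ((hc y).trans h))⟩

/-! ### §3 A quadratic field in `L₀ ∩ L₁` moved by conjugation: no additive rank, every family degenerate -/

omit [∀ i, IsCMField (K i)] in
/-- An embedding `k → K_i` of a subfield `k ≤ L_i = ι_i(K_i)` (`K_i` Galois). [folklore] -/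
private theorem nonempty_ringHom_of_le_normalClosure (i : I) [IsGalois ℚ (K i)] {k : IntermediateField ℚ ℂ}
    (hk : k ≤ normalClosure ℚ (K i) ℂ) : Nonempty (↥k →+* K i) := by
  obtain ⟨s⟩ : Nonempty (K i →+* ℂ) := inferInstance
  have hk' : k ≤ s.toRatAlgHom.fieldRange := by rwa [← normalClosure_eq_fieldRange_of_normal s.toRatAlgHom]
  have hk'' : ∀ x : ℂ, x ∈ k → x ∈ s.toRatAlgHom.range := fun x hx =>
    (AlgHom.mem_range _).2 (AlgHom.mem_fieldRange.1 (hk' hx))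
  let incl : ↥k →+* ↥s.toRatAlgHom.range :=
    { toFun := fun x => ⟨x.1, hk'' x.1 x.2⟩
      map_one' := rfl
      map_mul' := fun _ _ => rfl
      map_zero' := rfl
      map_add' := fun _ _ => rfl }
  exact ⟨(AlgEquiv.ofInjectiveField s.toRatAlgHom).symm.toRingEquiv.toRingHom.comp incl⟩

/-- A quadratic subfield of `ℂ` moved by conjugation is totally complex. [cite: Shimura1998, §18.1] -/
private theorem isTotallyComplex_of_exists_conj_ne {k : IntermediateField ℚ ℂ} [NumberField ↥k]
    (hk2 : finrank ℚ ↥k = 2) (hkx : ∃ x ∈ k, starRingEnd ℂ x ≠ x) : IsTotallyComplex ↥k := by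
  obtain ⟨x, hxk, hxne⟩ := hkx
  refine isTotallyComplex_of_finrank_eq_two_of_conjugate_ne hk2 (algebraMap ↥k ℂ) fun h => ?_
  have := RingHom.congr_fun h ⟨x, hxk⟩
  rw [ComplexEmbedding.conjugate_coe_eq] at this
  exact hxne this

section Family

variable [Fintype I]

open scoped Classical in
/-- **A shared imaginary quadratic field inside `L₀ ∩ L₁`, odd half-degrees: the rank is NOT additive** —
`cmFamilyRank Φ + |I| < Σ_i cmTypeRank Φ_i + 1` (`rank Hg(∏ A_i) < Σ rank Hg(A_i)`) for EVERY family `Φ`.  If `k ≤ L₀ ∩ L₁`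
is a quadratic field with some `x ∈ k`, `x̄ ≠ x` (so `k` is imaginary quadratic, embedded into `K_{i₀}`, `K_{i₁}` through
`L_i = ι_i(K_i)`), and `[K_{i₀} : ℚ]/2`, `[K_{i₁} : ℚ]/2` are odd, both `k`-signature defects are non-zero
(`SharedImaginaryQuadraticDegenerate`). [cite: Gordon1999HodgeAVSurvey, §3 Theorem (proof) and 7.5–7.7] -/
theorem cmFamilyRank_add_card_lt_of_quadratic_le_inf {i₀ i₁ : I} (h01 : i₀ ≠ i₁)
    [IsGalois ℚ (K i₀)] [IsGalois ℚ (K i₁)] (h₀ : Odd (finrank ℚ (K i₀) / 2)) (h₁ : Odd (finrank ℚ (K i₁) / 2))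
    {k : IntermediateField ℚ ℂ} (hk : k ≤ normalClosure ℚ (K i₀) ℂ ⊓ normalClosure ℚ (K i₁) ℂ)
    (hk2 : finrank ℚ ↥k = 2) (hkx : ∃ x ∈ k, starRingEnd ℂ x ≠ x) (Φ : ∀ i, CMType (K i)) :
    CMAlgebra.cmFamilyRank Φ + Fintype.card I < (∑ i, cmTypeRank (Φ i)) + 1 := by
  haveI : Nonempty I := ⟨i₀⟩
  haveI : FiniteDimensional ℚ ↥k := finiteDimensional_of_le₅ (hk.trans inf_le_left)
  haveI : NumberField ↥k := NumberField.mk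
  haveI : IsTotallyComplex ↥k := isTotallyComplex_of_exists_conj_ne hk2 hkx
  obtain ⟨j₀⟩ := nonempty_ringHom_of_le_normalClosure (K := K) i₀ (hk.trans inf_le_left)
  obtain ⟨j₁⟩ := nonempty_ringHom_of_le_normalClosure (K := K) i₁ (hk.trans inf_le_right)
  refine cmFamilyRank_add_card_lt_of_shared_quadratic (k := ↥k) hk2 (algebraMap ↥k ℂ) h01 j₀ j₁ Φ
    (sum_ksign_ne_zero_of_odd (algebraMap ↥k ℂ) j₀ (Φ i₀) ?_) (sum_ksign_ne_zero_of_odd (algebraMap ↥k ℂ) j₁ (Φ i₁) ?_)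
  · have := two_mul_card_filter_mem_cmType (Φ i₀)
    rwa [← this, Nat.mul_div_cancel_left _ two_pos] at h₀
  · have := two_mul_card_filter_mem_cmType (Φ i₁)
    rwa [← this, Nat.mul_div_cancel_left _ two_pos] at h₁

/-- **… hence EVERY family of CM types of the `K_i` is degenerate.** [cite: Gordon1999HodgeAVSurvey, 7.5–7.7] -/
theorem not_isNondegenerateFamily_of_quadratic_le_inf {i₀ i₁ : I} (h01 : i₀ ≠ i₁)
    [IsGalois ℚ (K i₀)] [IsGalois ℚ (K i₁)] (h₀ : Odd (finrank ℚ (K i₀) / 2)) (h₁ : Odd (finrank ℚ (K i₁) / 2))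
    {k : IntermediateField ℚ ℂ} (hk : k ≤ normalClosure ℚ (K i₀) ℂ ⊓ normalClosure ℚ (K i₁) ℂ)
    (hk2 : finrank ℚ ↥k = 2) (hkx : ∃ x ∈ k, starRingEnd ℂ x ≠ x) (Φ : ∀ i, CMType (K i)) :
    ¬ CMAlgebra.IsNondegenerateFamily Φ := by
  haveI : Nonempty I := ⟨i₀⟩
  haveI : FiniteDimensional ℚ ↥k := finiteDimensional_of_le₅ (hk.trans inf_le_left)
  haveI : NumberField ↥k := NumberField.mk
  haveI : IsTotallyComplex ↥k := isTotallyComplex_of_exists_conj_ne hk2 hkx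
  obtain ⟨j₀⟩ := nonempty_ringHom_of_le_normalClosure (K := K) i₀ (hk.trans inf_le_left)
  obtain ⟨j₁⟩ := nonempty_ringHom_of_le_normalClosure (K := K) i₁ (hk.trans inf_le_right)
  exact not_isNondegenerateFamily_of_shared_quadratic_of_odd (k := ↥k) hk2 (algebraMap ↥k ℂ) h01 j₀ j₁ h₀ h₁ Φ

open scoped Classical in
/-- **… and no partial conjugations exist** (they would make the rank additive,
`CMTypeRankPartialConjugation`). [cite: Gordon1999HodgeAVSurvey, §3 Theorem (proof)] -/
theorem not_forall_exists_partialConj_of_quadratic_le_inf {i₀ i₁ : I} (h01 : i₀ ≠ i₁)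
    [IsGalois ℚ (K i₀)] [IsGalois ℚ (K i₁)] (h₀ : Odd (finrank ℚ (K i₀) / 2)) (h₁ : Odd (finrank ℚ (K i₁) / 2))
    {k : IntermediateField ℚ ℂ} (hk : k ≤ normalClosure ℚ (K i₀) ℂ ⊓ normalClosure ℚ (K i₁) ℂ)
    (hk2 : finrank ℚ ↥k = 2) (hkx : ∃ x ∈ k, starRingEnd ℂ x ≠ x) :
    ¬ ∀ i : I, ∃ σ : ℂ ≃+* ℂ, (∀ s : K i →+* ℂ, σ • s = (starRingAut : ℂ ≃+* ℂ) • s) ∧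
      ∀ j, j ≠ i → ∀ s : K j →+* ℂ, σ • s = s := by
  haveI : Nonempty I := ⟨i₀⟩
  haveI : FiniteDimensional ℚ ↥k := finiteDimensional_of_le₅ (hk.trans inf_le_left)
  haveI : NumberField ↥k := NumberField.mk
  haveI : IsTotallyComplex ↥k := isTotallyComplex_of_exists_conj_ne hk2 hkx
  obtain ⟨j₀⟩ := nonempty_ringHom_of_le_normalClosure (K := K) i₀ (hk.trans inf_le_left)
  obtain ⟨j₁⟩ := nonempty_ringHom_of_le_normalClosure (K := K) i₁ (hk.trans inf_le_right)
  have Φ : ∀ i, CMType (K i) := fun i => Classical.choice (CMTypeCount.nonempty_cmType_iff_isTotallyComplex.2 inferInstance)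
  refine not_forall_exists_partialConj_of_shared_quadratic (k := ↥k) hk2 (algebraMap ↥k ℂ) h01 j₀ j₁ Φ
    (sum_ksign_ne_zero_of_odd (algebraMap ↥k ℂ) j₀ (Φ i₀) ?_) (sum_ksign_ne_zero_of_odd (algebraMap ↥k ℂ) j₁ (Φ i₁) ?_)
  · have := two_mul_card_filter_mem_cmType (Φ i₀)
    rwa [← this, Nat.mul_div_cancel_left _ two_pos] at h₀
  · have := two_mul_card_filter_mem_cmType (Φ i₁)
    rwa [← this, Nat.mul_div_cancel_left _ two_pos] at h₁

/-! ### §4 The parity dichotomy for two Galois CM fields of degree `≡ 2 (mod 4)` -/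

omit [Fintype I] in
/-- **`[L₀ ∩ L₁ : ℚ]` even ⟹ a shared imaginary quadratic field**: for two Galois CM fields of degrees `2m₀`, `2m₁`
(`m₁` odd) whose closures meet in a field of even degree, `L₀ ∩ L₁` contains a quadratic field moved by complex
conjugation. [cite: Rotman1995, Thm. 7.41] [cite: Lang2002, VI §1 Thm. 1.1 and Cor. 1.4] -/
theorem exists_quadratic_le_inf_of_even_finrank_inf {i₀ i₁ : I} [IsGalois ℚ (K i₁)] {m₁ : ℕ} (hm₁ : Odd m₁)
    (h₁ : finrank ℚ (K i₁) = 2 * m₁)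
    (hev : Even (finrank ℚ ↥(normalClosure ℚ (K i₀) ℂ ⊓ normalClosure ℚ (K i₁) ℂ))) :
    ∃ k : IntermediateField ℚ ℂ, k ≤ normalClosure ℚ (K i₀) ℂ ⊓ normalClosure ℚ (K i₁) ℂ ∧ finrank ℚ ↥k = 2 ∧
      ∃ x ∈ k, starRingEnd ℂ x ≠ x :=
  exists_quadratic_le_of_even_finrank i₁ hm₁ h₁ inf_le_right hev

/-- **`[L₀ ∩ L₁ : ℚ]` even ⟹ the rank is never additive**: `cmFamilyRank Φ + |I| < Σ_i cmTypeRank Φ_i + 1` for every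
family `Φ` of CM types of two Galois CM fields of degrees `2m₀`, `2m₁`, `m₀`, `m₁` odd (no hypothesis `L₀ ≠ L₁`).
[cite: Gordon1999HodgeAVSurvey, §3 Theorem (proof) and 7.5–7.7] [cite: Rotman1995, Thm. 7.41] -/
theorem cmFamilyRank_add_card_lt_of_twice_odd_of_even_finrank_inf {m₀ m₁ : ℕ} (hm₀ : Odd m₀) (hm₁ : Odd m₁)
    {i₀ i₁ : I} (h01 : i₀ ≠ i₁) [IsGalois ℚ (K i₀)] [IsGalois ℚ (K i₁)]
    (h₀ : finrank ℚ (K i₀) = 2 * m₀) (h₁ : finrank ℚ (K i₁) = 2 * m₁)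
    (hev : Even (finrank ℚ ↥(normalClosure ℚ (K i₀) ℂ ⊓ normalClosure ℚ (K i₁) ℂ))) (Φ : ∀ i, CMType (K i)) :
    CMAlgebra.cmFamilyRank Φ + Fintype.card I < (∑ i, cmTypeRank (Φ i)) + 1 := by
  obtain ⟨k, hkM, hk2, hkx⟩ := exists_quadratic_le_inf_of_even_finrank_inf (i₀ := i₀) hm₁ h₁ hev
  refine cmFamilyRank_add_card_lt_of_quadratic_le_inf h01 ?_ ?_ hkM hk2 hkx Φ
  · rw [h₀, Nat.mul_div_cancel_left _ two_pos]; exact hm₀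
  · rw [h₁, Nat.mul_div_cancel_left _ two_pos]; exact hm₁

/-- **`[L₀ ∩ L₁ : ℚ]` even ⟹ EVERY family of CM types is degenerate** (two Galois CM fields of degrees `2m₀`, `2m₁`
with `m₀`, `m₁` odd; no hypothesis `L₀ ≠ L₁`): `¬ IsNondegenerateFamily Φ` whatever the types — on abelian varieties,
separating realisations carry exceptional Hodge classes on some `A₀^a × A₁^b`. [cite: Gordon1999HodgeAVSurvey, 7.5–7.7]
[cite: Rotman1995, Thm. 7.41] -/
theorem not_isNondegenerateFamily_of_twice_odd_of_even_finrank_inf {m₀ m₁ : ℕ} (hm₀ : Odd m₀) (hm₁ : Odd m₁)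
    {i₀ i₁ : I} (h01 : i₀ ≠ i₁) [IsGalois ℚ (K i₀)] [IsGalois ℚ (K i₁)]
    (h₀ : finrank ℚ (K i₀) = 2 * m₀) (h₁ : finrank ℚ (K i₁) = 2 * m₁)
    (hev : Even (finrank ℚ ↥(normalClosure ℚ (K i₀) ℂ ⊓ normalClosure ℚ (K i₁) ℂ))) (Φ : ∀ i, CMType (K i)) :
    ¬ CMAlgebra.IsNondegenerateFamily Φ := by
  obtain ⟨k, hkM, hk2, hkx⟩ := exists_quadratic_le_inf_of_even_finrank_inf (i₀ := i₀) hm₁ h₁ hev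
  refine not_isNondegenerateFamily_of_quadratic_le_inf h01 ?_ ?_ hkM hk2 hkx Φ
  · rw [h₀, Nat.mul_div_cancel_left _ two_pos]; exact hm₀
  · rw [h₁, Nat.mul_div_cancel_left _ two_pos]; exact hm₁

/-- **`[L₀ ∩ L₁ : ℚ]` even ⟹ no partial conjugations.** [cite: Gordon1999HodgeAVSurvey, §3 Theorem (proof)] -/
theorem not_forall_exists_partialConj_of_twice_odd_of_even_finrank_inf {m₀ m₁ : ℕ} (hm₀ : Odd m₀)
    (hm₁ : Odd m₁) {i₀ i₁ : I} (h01 : i₀ ≠ i₁) [IsGalois ℚ (K i₀)] [IsGalois ℚ (K i₁)]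
    (h₀ : finrank ℚ (K i₀) = 2 * m₀) (h₁ : finrank ℚ (K i₁) = 2 * m₁)
    (hev : Even (finrank ℚ ↥(normalClosure ℚ (K i₀) ℂ ⊓ normalClosure ℚ (K i₁) ℂ))) :
    ¬ ∀ i : I, ∃ σ : ℂ ≃+* ℂ, (∀ s : K i →+* ℂ, σ • s = (starRingAut : ℂ ≃+* ℂ) • s) ∧
      ∀ j, j ≠ i → ∀ s : K j →+* ℂ, σ • s = s := by
  obtain ⟨k, hkM, hk2, hkx⟩ := exists_quadratic_le_inf_of_even_finrank_inf (i₀ := i₀) hm₁ h₁ hev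
  refine not_forall_exists_partialConj_of_quadratic_le_inf h01 ?_ ?_ hkM hk2 hkx
  · rw [h₀, Nat.mul_div_cancel_left _ two_pos]; exact hm₀
  · rw [h₁, Nat.mul_div_cancel_left _ two_pos]; exact hm₁

/-- **The parity dichotomy for two Galois CM fields of degree `≡ 2 (mod 4)`.**  For Galois CM fields `K_{i₀}`, `K_{i₁}`
of degrees `2m₀`, `2m₁` with `m₀`, `m₁` odd: EITHER `[L₀ ∩ L₁ : ℚ]` is odd — then `L₀ ∩ L₁` is totally real and both
slots carry PARTIAL CONJUGATIONS (additive rank; on abelian varieties `B• = D•` and the Hodge conjecture for every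
`A₀^a × A₁^b` of realisations of nondegenerate types) — OR it is even — then the fields share an imaginary quadratic
field and EVERY family of CM types is degenerate. [cite: Gordon1999HodgeAVSurvey, §3 Theorem and 7.5–7.7]
[cite: Rotman1995, Thm. 7.41] -/
theorem forall_exists_partialConj_pair_or_not_isNondegenerateFamily_of_twice_odd {m₀ m₁ : ℕ} (hm₀ : Odd m₀)
    (hm₁ : Odd m₁) {i₀ i₁ : I} (h01 : i₀ ≠ i₁) (hI : ∀ j, j = i₀ ∨ j = i₁) [IsGalois ℚ (K i₀)] [IsGalois ℚ (K i₁)]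
    (h₀ : finrank ℚ (K i₀) = 2 * m₀) (h₁ : finrank ℚ (K i₁) = 2 * m₁) :
    (Odd (finrank ℚ ↥(normalClosure ℚ (K i₀) ℂ ⊓ normalClosure ℚ (K i₁) ℂ)) ∧
      ∀ i : I, ∃ σ : ℂ ≃+* ℂ, (∀ s : K i →+* ℂ, σ • s = (starRingAut : ℂ ≃+* ℂ) • s) ∧
        ∀ j, j ≠ i → ∀ s : K j →+* ℂ, σ • s = s) ∨
      (Even (finrank ℚ ↥(normalClosure ℚ (K i₀) ℂ ⊓ normalClosure ℚ (K i₁) ℂ)) ∧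
        ∀ Φ : ∀ i, CMType (K i), ¬ CMAlgebra.IsNondegenerateFamily Φ) := by
  rcases Nat.even_or_odd (finrank ℚ ↥(normalClosure ℚ (K i₀) ℂ ⊓ normalClosure ℚ (K i₁) ℂ)) with hev | hodd
  · exact Or.inr ⟨hev, fun Φ => not_isNondegenerateFamily_of_twice_odd_of_even_finrank_inf hm₀ hm₁ h01 h₀ h₁ hev Φ⟩
  · exact Or.inl ⟨hodd, forall_exists_partialConj_pair_of_odd_finrank h01 hI hodd⟩

/-- **Partial conjugations exist iff `[L₀ ∩ L₁ : ℚ]` is odd** (two slots, Galois CM fields of degrees `2m₀`, `2m₁`,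
`m₀`, `m₁` odd). [cite: Gordon1999HodgeAVSurvey, §3 Theorem (proof)] [cite: Rotman1995, Thm. 7.41] -/
theorem forall_exists_partialConj_iff_odd_finrank_inf_of_twice_odd {m₀ m₁ : ℕ} (hm₀ : Odd m₀) (hm₁ : Odd m₁)
    {i₀ i₁ : I} (h01 : i₀ ≠ i₁) (hI : ∀ j, j = i₀ ∨ j = i₁) [IsGalois ℚ (K i₀)] [IsGalois ℚ (K i₁)]
    (h₀ : finrank ℚ (K i₀) = 2 * m₀) (h₁ : finrank ℚ (K i₁) = 2 * m₁) :
    (∀ i : I, ∃ σ : ℂ ≃+* ℂ, (∀ s : K i →+* ℂ, σ • s = (starRingAut : ℂ ≃+* ℂ) • s) ∧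
        ∀ j, j ≠ i → ∀ s : K j →+* ℂ, σ • s = s) ↔
      Odd (finrank ℚ ↥(normalClosure ℚ (K i₀) ℂ ⊓ normalClosure ℚ (K i₁) ℂ)) := by
  refine ⟨fun hconj => ?_, fun hodd => forall_exists_partialConj_pair_of_odd_finrank h01 hI hodd⟩
  rcases Nat.even_or_odd (finrank ℚ ↥(normalClosure ℚ (K i₀) ℂ ⊓ normalClosure ℚ (K i₁) ℂ)) with hev | hodd
  · exact absurd hconj (not_forall_exists_partialConj_of_twice_odd_of_even_finrank_inf hm₀ hm₁ h01 h₀ h₁ hev)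
  · exact hodd

omit [Fintype I] in
/-- **`[L₀ ∩ L₁ : ℚ]` is even iff complex conjugation moves `L₀ ∩ L₁`** (Galois CM fields, `[K_{i₁} : ℚ] = 2m₁`, `m₁`
odd): odd-degree Galois subfields of `ℂ` are totally real, even-degree ones here contain an imaginary quadratic field.
[cite: Lang2002, VI §1 Thm. 1.1 and Cor. 1.4] [cite: Rotman1995, Thm. 7.41] -/
theorem even_finrank_inf_iff_exists_conj_ne {i₀ i₁ : I} [IsGalois ℚ (K i₁)] {m₁ : ℕ} (hm₁ : Odd m₁)
    (h₁ : finrank ℚ (K i₁) = 2 * m₁) :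
    Even (finrank ℚ ↥(normalClosure ℚ (K i₀) ℂ ⊓ normalClosure ℚ (K i₁) ℂ)) ↔
      ∃ x ∈ normalClosure ℚ (K i₀) ℂ ⊓ normalClosure ℚ (K i₁) ℂ, starRingEnd ℂ x ≠ x := by
  constructor
  · intro hev
    obtain ⟨k, hkM, -, x, hx, hne⟩ := exists_quadratic_le_inf_of_even_finrank_inf (i₀ := i₀) hm₁ h₁ hev
    exact ⟨x, hkM hx, hne⟩
  · rintro ⟨x, hx, hne⟩
    rcases Nat.even_or_odd (finrank ℚ ↥(normalClosure ℚ (K i₀) ℂ ⊓ normalClosure ℚ (K i₁) ℂ)) with hev | hodd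
    · exact hev
    · exfalso
      haveI : ∀ j : I, @Normal ℚ ↥(normalClosure ℚ (K j) ℂ) _ _ (IntermediateField.algebra' _) :=
        normal_normalClosure_complex
      haveI : FiniteDimensional ℚ ↥(normalClosure ℚ (K i₀) ℂ ⊓ normalClosure ℚ (K i₁) ℂ) :=
        finiteDimensional_of_le₅ inf_le_left
      exact hne (conj_apply_eq_of_odd_finrank _ hodd hx)

end Family

end Literature.NumberTheory.ComplexMultiplication

end
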